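import Summits.RiemannHypothesis.RiemannHypothesis.Theorems.Splittings.BombieriTruncMassSampling
import HarnessLib

/-!
# Splittings — x-wuc GEN-8 (xiv-f) 3/5: (K-comb) HELPER BAND from an ORDINATE BAND — slot combinatorics only

Cell rh-split, seat rh-split-x-wuc g8 (brief sha16 f79c5f09d8bcb036), card `run/shared/lean/pub/rh-split/cards/SPLIT-x-wuc.md` §14.
CARVE NOTE (lane (xiv-f), lead RULING #113): part 3/5 of the VERBATIM carve of §G8.4–§G8.12 of the FROZEN scratch
`HOME/rh-split-x-wuc/SplitXWucG8.lean` sha16 72896d9b60505e56 (rider 5 FINAL, x-wuc g8 DONE; ref g6 REPLAY PASS 13:08:54Z),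
source lines l.901–1170, by rh-split-typer-3 g0; §G8.1–§G8.3 are the landed `Splittings/BombieriTruncMassAware.lean` (p531810), whose
namespace `…Splittings.BombieriTruncMassAware` every part RE-OPENS (FQNs do not move); the scratch's `#print axioms` guards are not
carried (referee `--axioms` replay instead); untagged parameterised `def … : Prop` hypotheses (`LocBand`, `HelperBand`, `OrdinateBand`)
are kept VERBATIM (typer's discretion per HANDOFF-g8: predicates / discharged hypotheses, not Literature facts).

* G8.8 `OrdinateBand T₀ δ` (typed COUNTING hypothesis at slot level; untagged `def : Prop` with parameters — DISCHARGED in part 4 from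
  HSW), `key`/`rrep` (fold class pairs `{ρ, 1 − ρ̄}` to the right half-plane, one RIGHT representative per key), and
  `helperBand_of_ordinateBand`, `rh_iff_rhUpTo_and_boundedAwayAt_of_ordinateBand` (no analysis, no ζ-facts).
LABEL: RH-free combinatorics + CONDITIONAL bookkeeping row; certifies nothing about RH.
HONEST LABEL: «SPLITTING SEARCH over kernel-typed RH-EQUIVALENCES; a splitting A ∧ B ⟹ RH is CONDITIONAL bookkeeping
unless A and B are both proved; nothing here bears on the truth of RH.»
-/

set_option linter.dupNamespace false

noncomputable section

open scoped Classical ComplexConjugate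
open Set Filter Topology Complex MeasureTheory

namespace Summit.RiemannHypothesis.RiemannHypothesis.Theorems.Splittings.BombieriTruncMassAware

open Literature.NumberTheory.LFunctions Literature.NumberTheory.LFunctions.Bombieri2000
open Summit.RiemannHypothesis.RiemannHypothesis.Theses.RuelleBand
open Summit.RiemannHypothesis.RiemannHypothesis.Theorems.Splittings.BombieriTruncEigen
open Summit.RiemannHypothesis.RiemannHypothesis.Theorems.Splittings.BombieriFozNoDep
open Summit.RiemannHypothesis.RiemannHypothesis.Theorems.Splittings.BombieriTruncGram
open Summit.RiemannHypothesis.RiemannHypothesis.Theorems.Splittings.BombieriTruncPairing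
open Summit.RiemannHypothesis.RiemannHypothesis.Theorems.Splittings.BombieriTruncScreening
open Summit.RiemannHypothesis.RiemannHypothesis.Theorems.Splittings.BombieriTruncBandGap
open Summit.RiemannHypothesis.RiemannHypothesis.Theorems.Splittings.BombieriTruncMultiplicity
open Summit.RiemannHypothesis.RiemannHypothesis.Theorems.Splittings.BombieriTruncEventualStrip
open Summit.RiemannHypothesis.RiemannHypothesis.Theorems.Splittings.BombieriTruncExactness
open Summit.RiemannHypothesis.RiemannHypothesis.Theorems.Splittings.BombieriTruncClump
open Summit.RiemannHypothesis.RiemannHypothesis.Theorems.Splittings.BombieriTruncOffLineSparse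
open Summit.RiemannHypothesis.RiemannHypothesis.Theorems.Splittings.BombieriTruncSynthesis
open Summit.RiemannHypothesis.RiemannHypothesis.Theorems.Splittings.BombieriTruncSynthesisScreening
open Summit.RiemannHypothesis.RiemannHypothesis.Theorems.Splittings.BombieriTruncSynthesisRows
open Literature.NumberTheory.DiophantineGeometry (RiemannHypothesisUpTo)

variable {N : ℕ}

/-! ### G8.8 (K-comb) HELPER BAND from an ORDINATE BAND — slot combinatorics only (no analysis, no ζ-facts)

`OrdinateBand T₀ δ` counts SLOTS of `Γ_N` (zeros with multiplicity) in short ordinate intervals near `τ₀`; it is what Riemann–von Mangoldt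
with an explicit `S(T)` bound delivers (g9 K-count).  Keys fold class pairs `{ρ, 1 − ρ̄}` to the right half-plane; one RIGHT representative
per key (the target's key excluded) is the helper family of `HelperBand`, and the band identity is a fiberwise count over keys. -/

/-- **ORDINATE BAND above `T₀` at width `δ`** (typed COUNTING hypothesis, slot level): for `τ₀ > T₀` and windows `Λ ≤ τ₀/8π`, eventually in
`N`, every ordinate interval `(τ₀ + a, τ₀ + b]` with `[a, b] ⊆ [−Λ, Λ]`, `b − a ≤ 4`, holds `D(τ₀)(b − a) ± δ·D(τ₀)` slots of `Γ_N`.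
[new; typed hypothesis — from `zetaZeroCount` asymptotics with explicit `S(T)`, g9 K-count] -/
def OrdinateBand (T₀ δ : ℝ) : Prop :=
  ∀ τ₀ : ℝ, T₀ < τ₀ → ∀ Λ : ℝ, 0 < Λ → Λ ≤ τ₀ / (8 * Real.pi) → ∃ N₀ : ℕ, ∀ N : ℕ, N₀ ≤ N →
    ∀ a b : ℝ, -Λ ≤ a → a < b → b ≤ Λ → b - a ≤ 4 →
      |((((Finset.univ : Finset (truncIdx N)).filter (fun i ↦ a < tau i - τ₀ ∧ tau i - τ₀ ≤ b)).card : ℕ) : ℝ) -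
          zdens τ₀ * (b - a)| ≤ δ * zdens τ₀

open scoped Classical in
/-- KEY of a slot: its zero folded to `Re ≥ ½` (`ρ ↦ ρ` on or right of the line, `ρ ↦ 1 − ρ̄` left of it); a class pair shares one key. -/
noncomputable def key (i : truncIdx N) : ℂ :=
  if 1 / 2 ≤ (i : ZeroIdx).val.re then (i : ZeroIdx).val else 1 - conj (i : ZeroIdx).val

open scoped Classical in
/-- RIGHT representative of a slot's class pair. -/
noncomputable def rrep (i : truncIdx N) : truncIdx N := if 1 / 2 ≤ (i : ZeroIdx).val.re then i else tbar i

/-- The key of a slot has the slot's ordinate as imaginary part. -/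
theorem key_im (i : truncIdx N) : (key i).im = tau i := by
  unfold key tau
  split_ifs <;> simp

/-- Keys lie in the closed right half `Re ≥ ½`. -/
theorem key_re (i : truncIdx N) : 1 / 2 ≤ (key i).re := by
  unfold key
  split_ifs with h
  · exact h
  · have h' := not_le.mp h
    simp
    linarith

/-- The right representative of a slot carries the slot's key as its zero. -/
theorem val_rrep (i : truncIdx N) : ((rrep i : truncIdx N) : ZeroIdx).val = key i := by
  unfold rrep key
  split_ifs
  · rfl
  · exact val_tbar _

/-- `key i = ρ_j` for a slot `j` on or right of the line iff `i` is in the class of `j` or (`j` off-line) of its mirror. -/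
theorem key_eq_iff {i j : truncIdx N} (hj : 1 / 2 ≤ ((j : truncIdx N) : ZeroIdx).val.re) :
    key i = (j : ZeroIdx).val ↔ i ∈ fib j ∨ ((j : ZeroIdx).OffLine ∧ i ∈ fib (tbar j)) := by
  rw [mem_fib, mem_fib, val_tbar]
  unfold key
  split_ifs with h
  · constructor
    · intro h1
      exact Or.inl h1
    · rintro (h1 | ⟨hoff, h1⟩)
      · exact h1
      · exfalso
        have hre := congrArg Complex.re h1
        simp at hre
        exact hoff (by linarith)
  · have h' := not_le.mp h
    constructor
    · intro h1
      have hre := congrArg Complex.re h1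
      simp at hre
      refine Or.inr ⟨?_, ?_⟩
      · intro hj'
        linarith
      · rw [← h1]
        simp
    · rintro (h1 | ⟨_, h1⟩)
      · exfalso
        rw [h1] at h'
        linarith
      · rw [h1]
        simp

/-- The number of slots with a given key is the helper WEIGHT of its right representative (`m` on-line, `2m` off-line). -/
theorem card_filter_key_eq {j : truncIdx N} (hj : 1 / 2 ≤ ((j : truncIdx N) : ZeroIdx).val.re) :
    ((((Finset.univ : Finset (truncIdx N)).filter (fun i ↦ key i = (j : ZeroIdx).val)).card : ℕ) : ℝ) = hwt j := by
  by_cases hoff : (j : ZeroIdx).OffLine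
  · have hset : (Finset.univ : Finset (truncIdx N)).filter (fun i ↦ key i = (j : ZeroIdx).val) = fib j ∪ fib (tbar j) := by
      ext i
      simp only [Finset.mem_filter, Finset.mem_univ, true_and, Finset.mem_union, key_eq_iff hj]
      simp [hoff]
    have hdisj : Disjoint (fib j) (fib (tbar j)) :=
      Finset.disjoint_left.2 fun x hx hx' ↦ not_mem_fib_tbar_of_mem hoff hx hx'
    rw [hset, Finset.card_union_of_disjoint hdisj, card_fib_tbar]
    unfold hwt
    rw [if_pos hoff]
    push_cast
    ring
  · have hset : (Finset.univ : Finset (truncIdx N)).filter (fun i ↦ key i = (j : ZeroIdx).val) = fib j := by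
      ext i
      simp only [Finset.mem_filter, Finset.mem_univ, true_and, key_eq_iff hj]
      simp [hoff]
    rw [hset]
    unfold hwt
    rw [if_neg hoff]

set_option maxHeartbeats 1600000 in
/-- **(K-comb) `OrdinateBand T₀ δ → HelperBand T₀ δ`**: the helper family is one right representative per key of `Γ_N` other than the
target's; its weighted local band IS the slot count (fiberwise over keys), and `2m₀ ≤ δ·D` is the band on `(−η, η]`, `η ↓ 0`. [new; unconditional] -/
theorem helperBand_of_ordinateBand {T₀ δ : ℝ} (h : OrdinateBand T₀ δ) : HelperBand T₀ δ := by
  intro ρ hρ hre hτ Λ hΛ hΛcap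
  obtain ⟨N₀, hN₀⟩ := h ρ.im hτ Λ hΛ hΛcap
  obtain ⟨i₀, hi₀⟩ := exists_slot hρ
  refine ⟨max N₀ ⌈‖ρ - 1 / 2‖⌉₊, fun N hN ↦ ?_⟩
  have hN₀N : N₀ ≤ N := le_trans (le_max_left _ _) hN
  have hceil : (⌈‖ρ - 1 / 2‖⌉₊ : ℝ) ≤ N := by exact_mod_cast le_trans (le_max_right N₀ _) hN
  have hi₀N : i₀ ∈ truncIdx N := mem_truncIdx_of_le (by rw [hi₀]; exact (Nat.le_ceil _).trans hceil)
  obtain ⟨j₀, hj₀⟩ : ∃ j₀ : truncIdx N, ((j₀ : truncIdx N) : ZeroIdx).val = ρ := ⟨⟨i₀, hi₀N⟩, hi₀⟩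
  have hj : (j₀ : ZeroIdx).OffLine := by
    show (j₀ : ZeroIdx).val.re ≠ 1 / 2
    rw [hj₀]; exact ne_of_gt hre
  have hj₀re : 1 / 2 ≤ ((j₀ : truncIdx N) : ZeroIdx).val.re := by rw [hj₀]; exact hre.le
  have htau0 : tau j₀ = ρ.im := by unfold tau; rw [hj₀]
  have hband := hN₀ N hN₀N
  -- keys other than `ρ`, enumerated by `Fin n`
  set K : Finset ℂ := ((Finset.univ : Finset (truncIdx N)).filter (fun i ↦ key i ≠ ρ)).image key with hKdef
  have hKmem : ∀ w ∈ K, ∃ i : truncIdx N, key i ≠ ρ ∧ key i = w := fun w hw ↦ by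
    obtain ⟨i, hi, rfl⟩ := Finset.mem_image.1 hw
    exact ⟨i, (Finset.mem_filter.1 hi).2, rfl⟩
  choose pick hpick_ne hpick_eq using hKmem
  have hρK : ρ ∉ K := fun hK ↦ hpick_ne ρ hK (hpick_eq ρ hK)
  set n : ℕ := K.card with hndef
  set e := K.equivFin with hedef
  set z : Fin n → ℂ := fun k ↦ ((e.symm k : K) : ℂ) with hzdef
  have hzK : ∀ k, z k ∈ K := fun k ↦ (e.symm k).2
  set s : Fin n → truncIdx N := fun k ↦ rrep (pick (z k) (hzK k)) with hsdef
  have hsval : ∀ k, ((s k : truncIdx N) : ZeroIdx).val = z k := fun k ↦ by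
    rw [hsdef]
    show ((rrep (pick (z k) (hzK k)) : truncIdx N) : ZeroIdx).val = z k
    rw [val_rrep, hpick_eq (z k) (hzK k)]
  have hsre : ∀ k, 1 / 2 ≤ ((s k : truncIdx N) : ZeroIdx).val.re := fun k ↦ by
    rw [hsdef]
    show 1 / 2 ≤ ((rrep (pick (z k) (hzK k)) : truncIdx N) : ZeroIdx).val.re
    rw [val_rrep]; exact key_re _
  have hzne : ∀ k, z k ≠ ρ := fun k ↦ by
    rw [← hpick_eq (z k) (hzK k)]; exact hpick_ne (z k) (hzK k)
  have htauk : ∀ k, tau (s k) = (z k).im := fun k ↦ by unfold tau; rw [hsval k]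
  refine ⟨j₀, hj₀, n, s, ?_, ?_, ?_, ?_, ?_⟩
  · -- different helpers carry different zeros
    intro k l hkl
    rw [hsval, hsval] at hkl
    exact e.symm.injective (Subtype.ext hkl)
  · -- off-line helpers are right of the line
    intro k hoff
    exact lt_of_le_of_ne (hsre k) (fun h' ↦ hoff h'.symm)
  · -- no helper in the target's classes
    intro k
    refine ⟨?_, ?_⟩
    · rw [hsval, hj₀]; exact hzne k
    · rw [hsval, val_tbar, hj₀]
      intro h'
      have h1 := congrArg Complex.re h'
      simp at h1
      have h2 := hsre k
      rw [hsval] at h2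
      linarith
  · -- 2 m₀ ≤ δ·D from the band on (−η, η]
    have hm : ∀ η : ℝ, 0 < η → η ≤ Λ → η ≤ 2 →
        2 * ((fib j₀).card : ℝ) ≤ zdens ρ.im * (2 * η) + δ * zdens ρ.im := by
      intro η hη hηΛ hη2
      have hb := hband (-η) η (by linarith) (by linarith) hηΛ (by linarith)
      have hsub : fib j₀ ∪ fib (tbar j₀) ⊆
          (Finset.univ : Finset (truncIdx N)).filter (fun i ↦ -η < tau i - ρ.im ∧ tau i - ρ.im ≤ η) := by
        intro i hi
        rw [Finset.mem_union, mem_fib, mem_fib, val_tbar, hj₀] at hi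
        have htau : tau i = ρ.im := by
          unfold tau
          rcases hi with h1 | h1 <;> simp [h1]
        simp only [Finset.mem_filter, Finset.mem_univ, true_and, htau]
        constructor <;> linarith
      have hcard := Finset.card_le_card hsub
      rw [Finset.card_union_of_disjoint (Finset.disjoint_left.2 fun x hx hx' ↦ not_mem_fib_tbar_of_mem hj hx hx'),
        card_fib_tbar] at hcard
      have hc' : 2 * ((fib j₀).card : ℝ) ≤
          ((((Finset.univ : Finset (truncIdx N)).filter (fun i ↦ -η < tau i - ρ.im ∧ tau i - ρ.im ≤ η)).card : ℕ) : ℝ) := by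
        have : 2 * (fib j₀).card ≤
            ((Finset.univ : Finset (truncIdx N)).filter (fun i ↦ -η < tau i - ρ.im ∧ tau i - ρ.im ≤ η)).card := by omega
        exact_mod_cast this
      have h3 := (abs_le.1 hb).2
      have h4 : zdens ρ.im * (η - -η) = zdens ρ.im * (2 * η) := by ring
      linarith
    rcases le_or_gt (zdens ρ.im) 0 with hD | hD
    · have := hm (min Λ 2) (lt_min hΛ two_pos) (min_le_left _ _) (min_le_right _ _)
      have h5 : zdens ρ.im * (2 * min Λ 2) ≤ 0 :=
        mul_nonpos_of_nonpos_of_nonneg hD (by positivity)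
      linarith
    · by_contra hcon
      have hcon' := not_le.mp hcon
      set η : ℝ := min (min Λ 2) ((2 * ((fib j₀).card : ℝ) - δ * zdens ρ.im) / (4 * zdens ρ.im)) with hηdef
      have hηpos : 0 < η := lt_min (lt_min hΛ two_pos) (div_pos (by linarith) (by linarith))
      have h6 := hm η hηpos ((min_le_left _ _).trans (min_le_left _ _)) ((min_le_left _ _).trans (min_le_right _ _))
      have h7 : η ≤ (2 * ((fib j₀).card : ℝ) - δ * zdens ρ.im) / (4 * zdens ρ.im) := min_le_right _ _
      have h8 : zdens ρ.im * (2 * η) ≤ (2 * ((fib j₀).card : ℝ) - δ * zdens ρ.im) / 2 := by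
        have := mul_le_mul_of_nonneg_left h7 (by linarith : (0 : ℝ) ≤ 2 * zdens ρ.im)
        have h9 : 2 * zdens ρ.im * ((2 * ((fib j₀).card : ℝ) - δ * zdens ρ.im) / (4 * zdens ρ.im)) =
            (2 * ((fib j₀).card : ℝ) - δ * zdens ρ.im) / 2 := by
          field_simp
          ring
        nlinarith
      linarith
  · -- the local band of the helper family IS the slot count
    intro a b ha hab hb hlen
    have hb' := hband a b ha hab hb hlen
    set P : Finset (truncIdx N) :=
      (Finset.univ : Finset (truncIdx N)).filter (fun i ↦ a < tau i - ρ.im ∧ tau i - ρ.im ≤ b) with hPdef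
    -- fibres over keys
    have hHt : ∀ i ∈ P, key i ∈ insert ρ K := by
      intro i _
      by_cases hk : key i = ρ
      · rw [hk]; exact Finset.mem_insert_self _ _
      · exact Finset.mem_insert_of_mem (Finset.mem_image_of_mem _ (Finset.mem_filter.2 ⟨Finset.mem_univ _, hk⟩))
    have hfib : P.card = ∑ w ∈ insert ρ K, (P.filter (fun i ↦ key i = w)).card :=
      Finset.card_eq_sum_card_fiberwise hHt
    rw [Finset.sum_insert hρK] at hfib
    have hfibre : ∀ w : ℂ, (P.filter (fun i ↦ key i = w)).card =
        if a < w.im - ρ.im ∧ w.im - ρ.im ≤ b then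
          ((Finset.univ : Finset (truncIdx N)).filter (fun i ↦ key i = w)).card else 0 := by
      intro w
      split_ifs with hw
      · congr 1
        ext i
        simp only [hPdef, Finset.mem_filter, Finset.mem_univ, true_and]
        constructor
        · rintro ⟨_, h2⟩; exact h2
        · intro h2
          refine ⟨?_, h2⟩
          rw [← key_im, h2]; exact hw
      · rw [Finset.card_eq_zero, Finset.filter_eq_empty_iff]
        intro i hi h2
        apply hw
        rw [hPdef, Finset.mem_filter] at hi
        rw [← h2, key_im]; exact hi.2
    -- the ρ-fibre is the virtual atom
    have hρfib : (((P.filter (fun i ↦ key i = ρ)).card : ℕ) : ℝ) =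
        if a < 0 ∧ 0 ≤ b then 2 * ((fib j₀).card : ℝ) else 0 := by
      rw [hfibre ρ, sub_self]
      by_cases h0 : a < 0 ∧ 0 ≤ b
      · rw [if_pos h0, if_pos h0, ← hj₀, card_filter_key_eq hj₀re]
        unfold hwt
        rw [if_pos hj]
      · rw [if_neg h0, if_neg h0]
        simp
    -- the K-fibres are the helper sum
    have hKsum : (((∑ w ∈ K, (P.filter (fun i ↦ key i = w)).card : ℕ)) : ℝ) =
        ∑ k ∈ Finset.univ.filter (fun k ↦ a < tau (s k) - tau j₀ ∧ tau (s k) - tau j₀ ≤ b), hwt (s k) := by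
      rw [Nat.cast_sum, Finset.sum_filter, ← Finset.sum_coe_sort K, ← Equiv.sum_comp e.symm]
      refine Finset.sum_congr rfl fun k _ ↦ ?_
      have hzk : ((e.symm k : K) : ℂ) = z k := rfl
      rw [hzk, hfibre (z k), htauk k, htau0]
      by_cases hc : a < (z k).im - ρ.im ∧ (z k).im - ρ.im ≤ b
      · rw [if_pos hc, if_pos hc, ← hsval k, card_filter_key_eq (hsre k)]
      · rw [if_neg hc, if_neg hc]
        simp
    have hid : (∑ k ∈ Finset.univ.filter (fun k ↦ a < tau (s k) - tau j₀ ∧ tau (s k) - tau j₀ ≤ b), hwt (s k)) +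
        (if a < 0 ∧ 0 ≤ b then 2 * ((fib j₀).card : ℝ) else 0) = ((P.card : ℕ) : ℝ) := by
      rw [hfib, Nat.cast_add, hρfib, hKsum]
      ring
    rw [hid]
    exact hb'

/-- Row **X-7♮♮**: `MassAwareSampling δ θ ∧ (δ·Φ < 8πθ on (0,½)) ∧ OrdinateBand T₀ δ ∧ T₀ ≥ 2π e^{2π}` ⟹ `RH ⟺ RH(T₀) ∧ B′₁([−1,1])` — the
ζ-side residual is now a pure SLOT-COUNT statement. [new; conditional bookkeeping] -/
theorem rh_iff_rhUpTo_and_boundedAwayAt_of_ordinateBand {T₀ δ θ : ℝ} (hθ : 0 < θ) (hS : MassAwareSampling δ θ)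
    (hcrit : ∀ κ₀ : ℝ, 0 < κ₀ → κ₀ < 1 / 2 → δ * Phi κ₀ < 8 * Real.pi * θ)
    (hO : OrdinateBand T₀ δ) (hT : 2 * Real.pi * Real.exp (2 * Real.pi) ≤ T₀) :
    _root_.RiemannHypothesis ↔
      RiemannHypothesisUpTo T₀ ∧ TruncNegEigenvalueBoundedAwayAt (Icc (-1 : ℝ) 1) 1 :=
  rh_iff_rhUpTo_and_boundedAwayAt_of_sampling hθ hS hcrit (helperBand_of_ordinateBand hO) hT

end Summit.RiemannHypothesis.RiemannHypothesis.Theorems.Splittings.BombieriTruncMassAware
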